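import Mathlib
import Summits.Ventures.DiscreteObjects.Mahler.CyclotomicIntegerLehmerAll
import Summits.Ventures.DiscreteObjects.Mahler.DobrowolskiSeparation

/-!
# A uniform house bound for cyclotomic integers (venture `DiscreteObjects`, target L)

Cell `pub-namedobj`, seat `pub-namedobj-mahler-g28`. Framing: lottery ticket; floor = certified bounds/negative ranges.

Corollary of Lehmer's conjecture for cyclotomic integers in the strong form `(5/2)^{deg α} ≤ M(α)^{10}`
([cite: BombieriGubler2001, Theorem 4.4.9], `CyclotomicIntegerLehmerAll`): since `M(α) ≤ house(α)^{deg α}`, every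
nonzero non-torsion cyclotomic integer `α = g(ζ_m)` has a conjugate of modulus `≥ (5/2)^{1/10} = 1.0959…`
(`exists_conjugate_norm_pow_ten_ge`) — a Schinzel–Zassenhaus bound for the integers of abelian (cyclotomic) fields,
UNIFORM in the degree (the general theorem, Dimitrov 2019, gives `2^{1/(4d)}`).  Bookkeeping; no new mathematics
claimed.
-/

namespace Summit.Ventures.DiscreteObjects.Mahler

open Polynomial

/-- **A uniform Schinzel–Zassenhaus bound for cyclotomic integers**: every nonzero non-torsion cyclotomic integer
`α = g(ζ_m)` has a conjugate `β` (a complex root of `minpoly_ℤ α`) with `|β|^{10} ≥ 5/2`, i.e. house `≥ (5/2)^{1/10}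
= 1.0959…`, uniformly in the degree (from `(5/2)^{deg α} ≤ M(α)^{10} ≤ house(α)^{10 deg α}`). -/
theorem exists_conjugate_norm_pow_ten_ge {m : ℕ} (hm : 0 < m) (g : ℤ[X]) {ζ : ℂ} (hζ : IsPrimitiveRoot ζ m)
    (h0 : aeval ζ g ≠ 0) (hnu : ∀ k : ℕ, 0 < k → aeval ζ g ^ k ≠ 1) :
    ∃ β ∈ ((minpoly ℤ (aeval ζ g)).map (Int.castRingHom ℂ)).roots, (5 : ℝ) / 2 ≤ ‖β‖ ^ 10 := by
  classical
  have hαint : IsIntegral ℤ (aeval ζ g) := isIntegral_aeval_of_isPrimitiveRoot hm g hζ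
  set f : ℤ[X] := minpoly ℤ (aeval ζ g) with hf
  have hmon : f.Monic := minpoly.monic hαint
  have hB := cyclotomicInteger_lehmer_bound_all hm g hζ h0 hnu
  have hL := lehmer_of_cyclotomicInteger_all hm g hζ h0 hnu
  have hLlow := lehmer_measure_lower_bound
  have hM : 1 < intMahlerMeasure f := by rw [hf]; linarith
  obtain ⟨z, hz, hz1, hmax⟩ := exists_root_norm_gt_one hmon hM
  refine ⟨z, hz, ?_⟩
  set d := f.natDegree with hd
  have hdpos : 0 < d := minpoly.natDegree_pos hαint
  set RC := (f.map (Int.castRingHom ℂ)).roots with hRC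
  have hcard : RC.card = d := by
    rw [hRC, splits_iff_card_roots.1 (IsAlgClosed.splits _),
      natDegree_map_eq_of_injective (Int.castRingHom ℂ).injective_int]
  have hMle : intMahlerMeasure f ≤ ‖z‖ ^ d := by
    have hMf : intMahlerMeasure f = (RC.map fun γ => max 1 ‖γ‖).prod := by
      unfold intMahlerMeasure
      rw [mahlerMeasure_eq_leadingCoeff_mul_prod_roots, (hmon.map (Int.castRingHom ℂ)).leadingCoeff, norm_one,
        one_mul]
    rw [hMf]
    calc (RC.map fun γ => max 1 ‖γ‖).prod ≤ (RC.map fun _ => ‖z‖).prod :=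
          Multiset.prod_map_le_prod_map₀ _ _ (fun γ _ => by positivity) (fun γ hγ => max_le hz1.le (hmax γ hγ))
      _ = ‖z‖ ^ d := by rw [Multiset.map_const', Multiset.prod_replicate, hcard]
  have hM0 : 0 ≤ intMahlerMeasure f := by linarith
  have h1 : ((5 : ℝ) / 2) ^ d ≤ (‖z‖ ^ 10) ^ d := by
    calc ((5 : ℝ) / 2) ^ d ≤ intMahlerMeasure f ^ 10 := hB
      _ ≤ (‖z‖ ^ d) ^ 10 := pow_le_pow_left₀ hM0 hMle 10
      _ = (‖z‖ ^ 10) ^ d := by rw [← pow_mul, ← pow_mul, mul_comm]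
  exact (pow_le_pow_iff_left₀ (by norm_num) (by positivity) hdpos.ne').1 h1

end Summit.Ventures.DiscreteObjects.Mahler
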